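import Literature.InformationTheory.QuantumCodes.ToricCodePhenomenological
import Summits.Ventures.QEC.Thresholds.ToricCodeThresholds
import Literature.Probability.RandomPlanarGeometry.SAWConnectiveConstantCubicUpperBound
import HarnessLib

/-!
# Toric-code threshold with NOISY syndrome measurement (phenomenological model): the certified
# instances of the Dennis–Kitaev–Landahl–Preskill cubic counting bound (LADDER-QEC Q5)

Venture QEC, `Summits/Ventures/QEC/Thresholds/` (qec-lead ruling 2026-08-26T22:51:09Z "D1"; the
phenomenological twin of `ToricCodeThresholds.lean`). HONEST FRAMING: every threshold theorem in
this file is CONDITIONAL on the ONE named fact `ToricCode.phenomThreshold_of_sawCountBound`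
(`Literature/…/ToricCodePhenomenological.lean`: DKLP 2002 §5.2–5.3 for `T` rounds of noisy syndrome
measurement closed by a perfect round, isotropic rates `q = p`, minimum-weight space-time decoding,
parametric in a per-length bound `∀ n, cₙ(ℤ³) ≤ C νⁿ`; STATEMENT ONLY until a Q5 prover lands
`…_holds`) — taken as the explicit hypothesis `(h : phenomThreshold_of_sawCountBound)`. What IS
proved here unconditionally: (a) the cubic walk-count INPUTS by IMPORT from
`Literature/Probability/RandomPlanarGeometry` (never restated) in the hypothesis shape
`SAWCountBound3 C ν`; (b) the arithmetic `p < p₀(ν) = (1 - √(1 - ν⁻²))/2 ⇒ 4ν²p(1-p) < 1`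
(shared with the 2D file: `thresholdValue`); (c) non-vacuity: minimum-weight space-time decoders
exist (`ToricCode.isMinWeight_stMinWeight`) and linear schedules `T(L) = L + 1` are polynomially
bounded (`isPolyBounded_succ`; constant schedules: see the tree's `LWE.IsPolyBounded.const` for the
polynomial-ℕ variant of the notion). Tiers (that of the walk-count input):

| instance | cubic walk-count input (tree, by name) | `ν` | `p₀(ν)` | tier |
|---|---|---|---|---|
| `phenomThreshold_elementary` | `SAW.Zd.count_succ_le` at `d = 3` (`cₙ ≤ 6·5ⁿ⁻¹`, DKLP eq. (saw_d)) | `5` | `(5-2√6)/10 ≈ .01010` | CERTIFIED (kernel), given `h` |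
| `phenomThreshold_of_connectiveConstant_three_le` | `SAW.Zd.tendsto_count_rpow 3` + ANY proved `μ(ℤ³) ≤ μ'` | every `ν > μ'` | `p₀(μ')` | that of the bound |
| `phenomThreshold_PT2000` | the named fact `SAW.Zd.PT2000_connectiveConstant_three_le` (`μ(ℤ³) ≤ 4.7387`, Pönitz–Tittmann `k = 14`) | `4.7387` | `≈ .01126 > .0112` | CERTIFIED-conditional (on `h` AND the fact) |

The `native_decide` value `μ(ℤ³) ≤ 4.76` (`SAW.Zd.connectiveConstant_three_le_476`, `p₀ > .0111`,
tier CHECKED-native) is kept OUT of this file (axiom hygiene) — see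
`ToricCodePhenomenologicalNative.lean`. NOT A THEOREM ANYWHERE: the printed `p, q < .0114`
(DKLP eq. (threshold_iso_num)), which rests on the numerical estimate `μ₃ ≈ 4.684` (CLAIM). No Monte
Carlo number appears here (the VALIDATED phenomenological-noise column is `bench/VALIDATED.tsv`).

## References

* [DennisEtAl2002] E. Dennis, A. Kitaev, A. Landahl, J. Preskill, J. Math. Phys. 43 (2002) 4452,
  arXiv:quant-ph/0110143, §5.2 ¶1 (`T = O(L)`), §5.3 eqs. (saw_d), (saw_3),
  (threshold_iso)–(threshold_iso_num), (fail_iso).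
* [PonitzTittmann2000] A. Pönitz, P. Tittmann, Electron. J. Combin. 7 (2000) R21, Table 2
  (`d = 3`, `k = 14`: `μ ≤ 4.7387`).
* [BDGS2012] Bauerschmidt–Duminil-Copin–Goodman–Slade, *Lectures on self-avoiding walks*, §1.3
  eq. (1.13) (`μ(d) ≤ 2d - 1`).
-/

noncomputable section

namespace Summit.Ventures.QEC.Thresholds

open Filter Topology Finset Matrix
open Literature.InformationTheory.QuantumCodes
open Literature.InformationTheory.QuantumCodes.ToricCode
open Literature.Probability.RandomPlanarGeometry

/-! ### The objects: round schedules, space-time decoder families, the failure family -/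

/-- The failure-probability family `(L, p) ↦ Prob_fail` of a space-time decoder family `D L` for
the `(L+1) × (L+1)` toric codes monitored for `T L` noisy rounds (plus the perfect closing round),
at isotropic rates `q = p` — the object whose vanishing as `L → ∞` defines "below threshold".
[cite: DennisEtAl2002, §5.2 (Prob_fail) and §5.3 (the case p = q)] -/
def phenomFailureFamily (T : ℕ → ℕ) (D : (L : ℕ) → STDecoder (L + 1) (T L)) : ℕ → ℝ → ℝ :=
  fun L p => phenomFailureProb (L + 1) (T L) (D L) p p

/-- The linear schedule `T(L) = L + 1` (as many rounds as the linear size; DKLP: "we can safely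
assume that `T = O(L)`") is polynomially bounded. [cite: DennisEtAl2002, §5.2 ¶1 (T = O(L))] -/
theorem isPolyBounded_succ : IsPolyBounded fun L => L + 1 :=
  ⟨1, 1, fun L => by push_cast; linarith⟩

/-- **Minimum-weight space-time decoders exist**: type-08's canonical `Decoder.minWeight` for the
space-time boundary map `stSyn` and the number of links is a minimum-weight decoder in the sense of
`Decoder.IsMinWeight` w.r.t. the space-time cycles (equal boundaries ⟺ the difference is a cycle,
by linearity of `∂`; the weight is negation-invariant) — DKLP's `E_min` for `q = p` ("If the
minimal chain is not unique, one of the minimal chains is selected").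
[cite: DennisEtAl2002, §5.1 eqs. (E_min), (weight)] -/
theorem ToricCode.isMinWeight_stMinWeight (L T : ℕ) [NeZero L] :
    (Decoder.minWeight (stSyn L T) hammingNorm).IsMinWeight (stSyn L T) (stCycles L T)
      hammingNorm := by
  refine Decoder.isMinWeight_minWeight _ _ _ (fun y z h => ?_) (fun x => ?_)
  · show stMatrix L T *ᵥ (y - z) = 0
    rw [Matrix.mulVec_sub]
    change stSyn L T y - stSyn L T z = 0
    rw [h, sub_self]
  · rw [show -x = x from funext fun i => ZMod.neg_eq_self_mod_two (x i)]

/-! ### The parametric corollary: `SAWCountBound3 C ν ⇒` threshold `≥ p₀(ν)` -/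

/-- Unpacking the named fact at one rate: under `SAWCountBound3 C ν` and a polynomially bounded
schedule, a minimum-weight space-time decoder family is below threshold at every `0 ≤ p ≤ ½` with
`4ν² p(1-p) < 1`. CONDITIONAL on `phenomThreshold_of_sawCountBound`.
[cite: DennisEtAl2002, §5.3 eq. (threshold_iso)] -/
theorem phenom_belowThreshold_of_sawCountBound3 (h : phenomThreshold_of_sawCountBound) {C ν : ℝ}
    (hν : 0 < ν) (hc : SAWCountBound3 C ν) {T : ℕ → ℕ} (hT : IsPolyBounded T)
    {D : (L : ℕ) → STDecoder (L + 1) (T L)}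
    (hD : ∀ L, (D L).IsMinWeight (stSyn (L + 1) (T L)) (stCycles (L + 1) (T L)) hammingNorm)
    {p : ℝ} (hp₀ : 0 ≤ p) (hp : p ≤ 1 / 2) (hlt : 4 * ν ^ 2 * (p * (1 - p)) < 1) :
    BelowThreshold (phenomFailureFamily T D) p :=
  h C ν hν hc T hT D hD p hp₀ hp hlt

/-- **The D4″ parametric theorem, phenomenological version, threshold form**: if `cₙ(ℤ³) ≤ C νⁿ`
for all `n` (`ν ≥ 1`), then for every polynomially bounded schedule of rounds and every
minimum-weight space-time decoder family, `p₀(ν) = (1 - √(1 - ν⁻²))/2` is a lower bound on the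
accuracy threshold of the toric code under phenomenological noise with `q = p`. CONDITIONAL on
`phenomThreshold_of_sawCountBound`. [cite: DennisEtAl2002, §5.3 eqs. (threshold_iso), (threshold_iso_num)] -/
theorem phenom_isThresholdLowerBound_of_sawCountBound3 (h : phenomThreshold_of_sawCountBound)
    {C ν : ℝ} (hν : 1 ≤ ν) (hc : SAWCountBound3 C ν) {T : ℕ → ℕ} (hT : IsPolyBounded T)
    {D : (L : ℕ) → STDecoder (L + 1) (T L)}
    (hD : ∀ L, (D L).IsMinWeight (stSyn (L + 1) (T L)) (stCycles (L + 1) (T L)) hammingNorm) :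
    IsThresholdLowerBound (phenomFailureFamily T D) (thresholdValue ν) := by
  intro p hp₀ hpp
  have hp : p ≤ 1 / 2 := hpp.le.trans (thresholdValue_le_half ν)
  have hlt : p * (1 - p) < thresholdValue ν * (1 - thresholdValue ν) :=
    mul_one_sub_lt_mul_one_sub hpp (by linarith [thresholdValue_le_half ν])
  have hν0 : 0 < ν := lt_of_lt_of_le one_pos hν
  have h4 : 4 * ν ^ 2 * (p * (1 - p)) < 1 := by
    calc 4 * ν ^ 2 * (p * (1 - p)) < 4 * ν ^ 2 * (thresholdValue ν * (1 - thresholdValue ν)) := by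
          gcongr
      _ = 1 := four_mul_sq_mul_thresholdValue hν
  exact phenom_belowThreshold_of_sawCountBound3 h hν0 hc hT hD hp₀ hp h4

/-- Limit form: if `∃ C, cₙ(ℤ³) ≤ C νⁿ` for EVERY `ν > μ'` (`μ' ≥ 1`), then already `p₀(μ')` is a
threshold lower bound (for `p < p₀(μ')` pick `ν` strictly between). CONDITIONAL on
`phenomThreshold_of_sawCountBound`. [cite: DennisEtAl2002, §5.3 eq. (threshold_iso)] -/
theorem phenom_isThresholdLowerBound_of_forall_gt (h : phenomThreshold_of_sawCountBound) {μ' : ℝ}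
    (hμ' : 1 ≤ μ') (hc : ∀ ν : ℝ, μ' < ν → ∃ C : ℝ, SAWCountBound3 C ν) {T : ℕ → ℕ}
    (hT : IsPolyBounded T) {D : (L : ℕ) → STDecoder (L + 1) (T L)}
    (hD : ∀ L, (D L).IsMinWeight (stSyn (L + 1) (T L)) (stCycles (L + 1) (T L)) hammingNorm) :
    IsThresholdLowerBound (phenomFailureFamily T D) (thresholdValue μ') := by
  intro p hp₀ hpp
  have hp : p ≤ 1 / 2 := hpp.le.trans (thresholdValue_le_half μ')
  have hlt : p * (1 - p) < thresholdValue μ' * (1 - thresholdValue μ') :=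
    mul_one_sub_lt_mul_one_sub hpp (by linarith [thresholdValue_le_half μ'])
  have hμ'0 : 0 < μ' := lt_of_lt_of_le one_pos hμ'
  have h4 : 4 * μ' ^ 2 * (p * (1 - p)) < 1 := by
    calc 4 * μ' ^ 2 * (p * (1 - p)) < 4 * μ' ^ 2 * (thresholdValue μ' * (1 - thresholdValue μ')) := by
          gcongr
      _ = 1 := four_mul_sq_mul_thresholdValue hμ'
  -- room to increase the base: choose `ν > μ'` with `4ν² p(1-p) < 1`
  have hpp' : 0 ≤ p * (1 - p) := mul_nonneg hp₀ (by linarith)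
  obtain ⟨ν, hμν, h4ν⟩ : ∃ ν : ℝ, μ' < ν ∧ 4 * ν ^ 2 * (p * (1 - p)) < 1 := by
    rcases hpp'.eq_or_lt with hz | hpos
    · exact ⟨μ' + 1, by linarith, by rw [← hz]; norm_num⟩
    · -- `ν := √((μ'² + 1/(4 p(1-p)))/2)`, squarely between
      set x := p * (1 - p) with hx
      have hμx : μ' ^ 2 < 1 / (4 * x) := by
        rw [lt_div_iff₀ (by positivity)]; nlinarith
      set ν := Real.sqrt ((μ' ^ 2 + 1 / (4 * x)) / 2) with hν
      have hνsq : ν ^ 2 = (μ' ^ 2 + 1 / (4 * x)) / 2 := by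
        rw [hν, Real.sq_sqrt (by positivity)]
      refine ⟨ν, ?_, ?_⟩
      · have : μ' ^ 2 < ν ^ 2 := by rw [hνsq]; linarith
        exact lt_of_pow_lt_pow_left₀ 2 (Real.sqrt_nonneg _) this
      · have : ν ^ 2 < 1 / (4 * x) := by rw [hνsq]; linarith
        have hx4 : 0 < 4 * x := by positivity
        rw [lt_div_iff₀ hx4] at this
        linarith
  obtain ⟨C, hC⟩ := hc ν hμν
  exact phenom_belowThreshold_of_sawCountBound3 h (hμ'0.trans hμν) hC hT hD hp₀ hp h4ν

/-! ### Instance 1 (tier CERTIFIED): DKLP's elementary cubic count, `ν = 5` -/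

/-- DKLP's elementary walk count on `ℤ³` in the hypothesis shape: `cₙ(ℤ³) ≤ (6/5)·5ⁿ` (the tree's
`SAW.Zd.count_succ_le` at `d = 3`: `c_{n+1} ≤ 6·5ⁿ`, with `c₀ = 1`).
[cite: DennisEtAl2002, §5.3 eq. (saw_d) (d = 3)] -/
theorem sawCountBound3_five : SAWCountBound3 (6 / 5) 5 := by
  intro n
  cases n with
  | zero =>
    rw [SAW.Zd.count_zero]
    norm_num
  | succ n =>
    have h := SAW.Zd.count_succ_le 3 n
    have h' : (SAW.Zd.count 3 (n + 1) : ℝ) ≤ 6 * 5 ^ n := by exact_mod_cast h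
    calc (SAW.Zd.count 3 (n + 1) : ℝ) ≤ 6 * 5 ^ n := h'
      _ = 6 / 5 * 5 ^ (n + 1) := by ring

/-- **Phenomenological toric threshold, elementary-count instance (tier CERTIFIED, given `h`)**:
for every polynomially bounded schedule of rounds and every minimum-weight space-time decoder
family, `p₀(5) = (1 - √(24/25))/2 = (5 - 2√6)/10 ≈ .0101` is a lower bound on the accuracy
threshold under phenomenological noise with equal qubit- and measurement-error rates. CONDITIONAL
on `phenomThreshold_of_sawCountBound`. [cite: DennisEtAl2002, §5.3 eqs. (saw_d), (threshold_iso)] -/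
theorem phenomThreshold_elementary (h : phenomThreshold_of_sawCountBound) {T : ℕ → ℕ}
    (hT : IsPolyBounded T) {D : (L : ℕ) → STDecoder (L + 1) (T L)}
    (hD : ∀ L, (D L).IsMinWeight (stSyn (L + 1) (T L)) (stCycles (L + 1) (T L)) hammingNorm) :
    IsThresholdLowerBound (phenomFailureFamily T D) (thresholdValue 5) :=
  phenom_isThresholdLowerBound_of_sawCountBound3 h (by norm_num) sawCountBound3_five hT hD

/-- The elementary phenomenological value in closed form: `p₀(5) = (5 - 2√6)/10`.
[cite: DennisEtAl2002, §5.3 eq. (threshold_iso_num) (with μ₃ replaced by 5)] -/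
theorem thresholdValue_five : thresholdValue 5 = (5 - 2 * Real.sqrt 6) / 10 := by
  unfold thresholdValue
  have h : (1 - 1 / (5 : ℝ) ^ 2) = (2 * Real.sqrt 6 / 5) ^ 2 := by
    rw [div_pow, mul_pow, Real.sq_sqrt (by norm_num : (0 : ℝ) ≤ 6)]
    norm_num
  rw [h, Real.sqrt_sq (by positivity)]
  ring

/-- Decimal enclosure: `.0101 < p₀(5) < .0102`. [cite: DennisEtAl2002, §5.3 eq. (threshold_iso_num)] -/
theorem thresholdValue_five_bounds :
    (0.0101 : ℝ) < thresholdValue 5 ∧ thresholdValue 5 < 0.0102 := by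
  unfold thresholdValue
  have hx : (1 - 1 / (5 : ℝ) ^ 2) = 24 / 25 := by norm_num
  rw [hx]
  constructor
  · have : Real.sqrt (24 / 25) < 0.9798 := by
      rw [Real.sqrt_lt' (by norm_num)]
      norm_num
    linarith
  · have : (0.9796 : ℝ) < Real.sqrt (24 / 25) := by
      rw [Real.lt_sqrt (by norm_num)]
      norm_num
    linarith

/-- The headline instance with everything chosen canonically: `T(L) = L + 1` rounds and the
canonical minimum-weight space-time decoders `Decoder.minWeight` — threshold `≥ p₀(5)`.
CONDITIONAL on `phenomThreshold_of_sawCountBound`. [cite: DennisEtAl2002, §5.3 eq. (threshold_iso)] -/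
theorem ToricCode.phenomThreshold_stMinWeight (h : phenomThreshold_of_sawCountBound) :
    IsThresholdLowerBound
      (phenomFailureFamily (fun L => L + 1)
        fun L => Decoder.minWeight (stSyn (L + 1) (L + 1)) hammingNorm)
      (thresholdValue 5) :=
  phenomThreshold_elementary h isPolyBounded_succ
    fun L => ToricCode.isMinWeight_stMinWeight (L + 1) (L + 1)

/-! ### Instance 2 (tier = that of the `μ(ℤ³)` bound): any proved `μ(ℤ³) ≤ μ'` -/

/-- From `cₙ(ℤ³)^{1/n} → μ(ℤ³)` (the tree's `SAW.Zd.tendsto_count_rpow 3`, Fekete): every `ν > μ(ℤ³)`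
admits a constant `C` with `cₙ(ℤ³) ≤ C νⁿ` for all `n`. [cite: BDGS2012, §1.3 eq. (1.12)] -/
theorem exists_sawCountBound3_of_connectiveConstant_lt {ν : ℝ}
    (hν : SAW.Zd.connectiveConstant 3 < ν) : ∃ C : ℝ, SAWCountBound3 C ν := by
  haveI : NeZero (3 : ℕ) := ⟨by norm_num⟩
  have hν0 : 0 < ν := lt_of_lt_of_le' hν (SAW.Zd.connectiveConstant_pos 3).le
  have ht := SAW.Zd.tendsto_count_rpow 3
  have hev : ∀ᶠ n : ℕ in atTop, (SAW.Zd.count 3 n : ℝ) ^ (1 / (n : ℝ)) < ν :=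
    ht (Iio_mem_nhds hν)
  obtain ⟨N, hN⟩ := eventually_atTop.1 hev
  -- beyond `N` (and `n ≥ 1`): `cₙ < νⁿ`
  have hlarge : ∀ n : ℕ, N ≤ n → 1 ≤ n → (SAW.Zd.count 3 n : ℝ) ≤ ν ^ n := by
    intro n hn hn1
    have h1 := hN n hn
    have hc0 : (0 : ℝ) ≤ SAW.Zd.count 3 n := Nat.cast_nonneg _
    have hn0 : (n : ℝ) ≠ 0 := by exact_mod_cast (show n ≠ 0 by omega)
    have : ((SAW.Zd.count 3 n : ℝ) ^ (1 / (n : ℝ))) ^ (n : ℝ) = SAW.Zd.count 3 n := by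
      rw [← Real.rpow_mul hc0, one_div_mul_cancel hn0, Real.rpow_one]
    calc (SAW.Zd.count 3 n : ℝ) = ((SAW.Zd.count 3 n : ℝ) ^ (1 / (n : ℝ))) ^ (n : ℝ) := this.symm
      _ ≤ ν ^ (n : ℝ) := Real.rpow_le_rpow (Real.rpow_nonneg hc0 _) h1.le (Nat.cast_nonneg n)
      _ = ν ^ n := Real.rpow_natCast ν n
  -- a constant absorbing the finitely many small `n`
  refine ⟨∑ k ∈ Finset.range (N + 1), (SAW.Zd.count 3 k : ℝ) / ν ^ k, fun n => ?_⟩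
  have hterm : ∀ k, 0 ≤ (SAW.Zd.count 3 k : ℝ) / ν ^ k := fun k => by positivity
  have hC1 : (1 : ℝ) ≤ ∑ k ∈ Finset.range (N + 1), (SAW.Zd.count 3 k : ℝ) / ν ^ k := by
    have h0 : (SAW.Zd.count 3 0 : ℝ) / ν ^ 0 = 1 := by
      rw [SAW.Zd.count_zero]; simp
    calc (1 : ℝ) = (SAW.Zd.count 3 0 : ℝ) / ν ^ 0 := h0.symm
      _ ≤ ∑ k ∈ Finset.range (N + 1), (SAW.Zd.count 3 k : ℝ) / ν ^ k :=
          Finset.single_le_sum (fun k _ => hterm k) (Finset.mem_range.2 (Nat.succ_pos N))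
  by_cases hn : n ≤ N
  · have hmem : n ∈ Finset.range (N + 1) := Finset.mem_range.2 (Nat.lt_succ_of_le hn)
    have hle : (SAW.Zd.count 3 n : ℝ) / ν ^ n ≤
        ∑ k ∈ Finset.range (N + 1), (SAW.Zd.count 3 k : ℝ) / ν ^ k :=
      Finset.single_le_sum (fun k _ => hterm k) hmem
    have hνn : 0 < ν ^ n := pow_pos hν0 n
    calc (SAW.Zd.count 3 n : ℝ) = (SAW.Zd.count 3 n : ℝ) / ν ^ n * ν ^ n := by field_simp
      _ ≤ (∑ k ∈ Finset.range (N + 1), (SAW.Zd.count 3 k : ℝ) / ν ^ k) * ν ^ n := by gcongr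
  · push Not at hn
    have hn1 : 1 ≤ n := by omega
    calc (SAW.Zd.count 3 n : ℝ) ≤ ν ^ n := hlarge n hn.le hn1
      _ = 1 * ν ^ n := (one_mul _).symm
      _ ≤ (∑ k ∈ Finset.range (N + 1), (SAW.Zd.count 3 k : ℝ) / ν ^ k) * ν ^ n := by gcongr

/-- **Phenomenological toric threshold from any bound on the cubic connective constant** (tier =
the tier of that bound): if `μ(ℤ³) ≤ μ'` with `μ' ≥ 1`, then `p₀(μ')` is a threshold lower bound for
every polynomially bounded schedule and every minimum-weight space-time decoder family. CONDITIONAL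
on `phenomThreshold_of_sawCountBound`. [cite: DennisEtAl2002, §5.3 eqs. (saw_3), (threshold_iso)] -/
theorem phenomThreshold_of_connectiveConstant_three_le (h : phenomThreshold_of_sawCountBound)
    {μ' : ℝ} (hμ'1 : 1 ≤ μ') (hμ : SAW.Zd.connectiveConstant 3 ≤ μ') {T : ℕ → ℕ}
    (hT : IsPolyBounded T) {D : (L : ℕ) → STDecoder (L + 1) (T L)}
    (hD : ∀ L, (D L).IsMinWeight (stSyn (L + 1) (T L)) (stCycles (L + 1) (T L)) hammingNorm) :
    IsThresholdLowerBound (phenomFailureFamily T D) (thresholdValue μ') :=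
  phenom_isThresholdLowerBound_of_forall_gt h hμ'1
    (fun _ hν => exists_sawCountBound3_of_connectiveConstant_lt (lt_of_le_of_lt hμ hν)) hT hD

/-- Consistency check of the two routes: the kernel-only bound `μ(ℤ³) ≤ 5` (the tree's
`SAW.Zd.connectiveConstant_le`) gives back Instance 1's value through Instance 2. CONDITIONAL on
`phenomThreshold_of_sawCountBound`. [cite: BDGS2012, §1.3 eq. (1.13)] -/
theorem phenomThreshold_elementary' (h : phenomThreshold_of_sawCountBound) {T : ℕ → ℕ}
    (hT : IsPolyBounded T) {D : (L : ℕ) → STDecoder (L + 1) (T L)}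
    (hD : ∀ L, (D L).IsMinWeight (stSyn (L + 1) (T L)) (stCycles (L + 1) (T L)) hammingNorm) :
    IsThresholdLowerBound (phenomFailureFamily T D) (thresholdValue 5) := by
  have hμ : SAW.Zd.connectiveConstant 3 ≤ 5 := by
    have := SAW.Zd.connectiveConstant_le 3 (by norm_num)
    norm_num at this
    exact this
  exact phenomThreshold_of_connectiveConstant_three_le h (by norm_num) hμ hT hD

/-! ### Instance 3 (tier CERTIFIED-conditional): the Pönitz–Tittmann value `μ(ℤ³) ≤ 4.7387` -/

/-- **Phenomenological toric threshold, Pönitz–Tittmann instance (tier CERTIFIED-conditional)**: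
granted the named fact `SAW.Zd.PT2000_connectiveConstant_three_le` (`μ(ℤ³) ≤ 4.7387`, Pönitz–Tittmann
2000 Table 2, `d = 3`, `k = 14`), `p₀(4.7387) ≈ .01126` is a threshold lower bound for every
polynomially bounded schedule and every minimum-weight space-time decoder family. CONDITIONAL on
`phenomThreshold_of_sawCountBound` AND on the connective-constant fact. (DKLP's printed `.0114`
would need `μ₃ ≤ 4.684`, a numerical estimate — CLAIM, not typed.)
[cite: DennisEtAl2002, §5.3 eqs. (saw_3), (threshold_iso_num)] -/
theorem phenomThreshold_PT2000 (h : phenomThreshold_of_sawCountBound)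
    (hμ : SAW.Zd.PT2000_connectiveConstant_three_le) {T : ℕ → ℕ} (hT : IsPolyBounded T)
    {D : (L : ℕ) → STDecoder (L + 1) (T L)}
    (hD : ∀ L, (D L).IsMinWeight (stSyn (L + 1) (T L)) (stCycles (L + 1) (T L)) hammingNorm) :
    IsThresholdLowerBound (phenomFailureFamily T D) (thresholdValue 4.7387) :=
  phenomThreshold_of_connectiveConstant_three_le h (by norm_num) hμ hT hD

/-- Decimal certificate: `.0112 < p₀(4.7387)`. [cite: DennisEtAl2002, §5.3 eq. (threshold_iso_num)] -/
theorem thresholdValue_PT2000_three_gt : (0.0112 : ℝ) < thresholdValue 4.7387 := by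
  unfold thresholdValue
  have : Real.sqrt (1 - 1 / (4.7387 : ℝ) ^ 2) < 0.9776 := by
    rw [Real.sqrt_lt' (by norm_num)]
    norm_num
  linarith

/-! ### The accuracy threshold `p_c` itself -/

/-- Under `SAWCountBound3 C ν` (`ν ≥ 1`), the accuracy threshold of every minimum-weight space-time
decoder family (any polynomially bounded schedule) is at least `p₀(ν)`. CONDITIONAL on
`phenomThreshold_of_sawCountBound`. [cite: DennisEtAl2002, §5.3 (lower bound on the accuracy threshold)] -/
theorem phenom_thresholdValue_le_accuracyThreshold (h : phenomThreshold_of_sawCountBound)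
    {C ν : ℝ} (hν : 1 ≤ ν) (hc : SAWCountBound3 C ν) {T : ℕ → ℕ} (hT : IsPolyBounded T)
    {D : (L : ℕ) → STDecoder (L + 1) (T L)}
    (hD : ∀ L, (D L).IsMinWeight (stSyn (L + 1) (T L)) (stCycles (L + 1) (T L)) hammingNorm) :
    thresholdValue ν ≤ accuracyThreshold (phenomFailureFamily T D) :=
  le_accuracyThreshold (phenom_isThresholdLowerBound_of_sawCountBound3 h hν hc hT hD)
    ((thresholdValue_le_half ν).trans (by norm_num))

/-- **`p_c ≥ (5 - 2√6)/10 ≈ .0101`** under phenomenological noise (`q = p`) for every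
minimum-weight space-time decoder family and every polynomially bounded schedule (tier CERTIFIED,
given `h`). CONDITIONAL on `phenomThreshold_of_sawCountBound`.
[cite: DennisEtAl2002, §5.3 eqs. (saw_d), (threshold_iso_num)] -/
theorem phenom_accuracyThreshold_ge_elementary (h : phenomThreshold_of_sawCountBound) {T : ℕ → ℕ}
    (hT : IsPolyBounded T) {D : (L : ℕ) → STDecoder (L + 1) (T L)}
    (hD : ∀ L, (D L).IsMinWeight (stSyn (L + 1) (T L)) (stCycles (L + 1) (T L)) hammingNorm) :
    (5 - 2 * Real.sqrt 6) / 10 ≤ accuracyThreshold (phenomFailureFamily T D) := by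
  rw [← thresholdValue_five]
  exact phenom_thresholdValue_le_accuracyThreshold h (by norm_num) sawCountBound3_five hT hD

/-- **`p_c > .0112`** under phenomenological noise (`q = p`), granted the Pönitz–Tittmann value
`μ(ℤ³) ≤ 4.7387` (tier CERTIFIED-conditional). CONDITIONAL on `phenomThreshold_of_sawCountBound`
AND `SAW.Zd.PT2000_connectiveConstant_three_le`. [cite: DennisEtAl2002, §5.3 eqs. (saw_3), (threshold_iso_num)] -/
theorem phenom_accuracyThreshold_gt_PT2000 (h : phenomThreshold_of_sawCountBound)
    (hμ : SAW.Zd.PT2000_connectiveConstant_three_le) {T : ℕ → ℕ} (hT : IsPolyBounded T)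
    {D : (L : ℕ) → STDecoder (L + 1) (T L)}
    (hD : ∀ L, (D L).IsMinWeight (stSyn (L + 1) (T L)) (stCycles (L + 1) (T L)) hammingNorm) :
    (0.0112 : ℝ) < accuracyThreshold (phenomFailureFamily T D) :=
  lt_of_lt_of_le thresholdValue_PT2000_three_gt
    (le_accuracyThreshold (phenomThreshold_PT2000 h hμ hT hD)
      ((thresholdValue_le_half _).trans (by norm_num)))

end Summit.Ventures.QEC.Thresholds

end
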